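import Summits.CriticalPhenomena.SAWScalingLimit.Theses.SAWLoopFugacityFlow
import Summits.CriticalPhenomena.SAWScalingLimit.Theorems.IsingBoundaryRatio.Negative.IsingBoundaryRatioNormalisation
import Literature.Probability.RandomPlanarGeometry.RestrictionHullsProofs
import Literature.Probability.RandomPlanarGeometry.RestrictionHullsRiemannProofs

/-!
# Line `pfaffian-slit-peeling` for the crux `IsingBoundaryRatio` (stmt-CriticalPhenomena-10650)

Route `SAWLoopFugacityFlow`, crux decl
`Summit.CriticalPhenomena.SAWScalingLimit.Theses.SAWLoopFugacityFlow.IsingBoundaryRatio` (rank 6, the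
`n = 1` anchor): for Dobrushin domains `D' ⊆ D` with the same marked points `a, b`, agreeing with `D`
in balls around `a` and `b`, endpoint approximations `(a_δ, b_δ)` of BOTH, a chordal uniformizer
`φ : (ℍ; 0, ∞) → (D; a, b)`, `A = closure (ℍ ∖ φ⁻¹ D')`, restriction data `(Φ, d = Φ'_A(0))`:
`⟨σ_{a_δ}σ_{b_δ}⟩^free_{Ω'_δ,β_c} / ⟨σ_{a_δ}σ_{b_δ}⟩^free_{Ω_δ,β_c} → d^{1/2}` (`δ → 0⁺`).

THE LINE (idea card `Ideas/pfaffian-slit-peeling.md`, triage r1-1/2/3 pass). Peel the crosscut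
`∂D' ∩ D` edge by edge, as a lattice slit grown from its foot on `∂D`: every intermediate graph
`G_k = Ω_δ − {e_0,…,e_{k-1}}` is a plain free-b.c. critical Ising slit graph, the
Groeneveld–Boel–Kasteleyn boundary Pfaffian turns each deletion into an EXACT nonnegative increment
of `log ⟨σ_aσ_b⟩` driven by a `2×2` boundary minor at the moving tip, and the increments are matched,
block by block along the slit, with the decrements of `½·log Φ'_{A_t}(0)` of the pulled-back partial
slits (the weight-`½` Loewner covariance density). Reductions: anchor locality (boundary-vertex
anchors suffice; the lemma shared by four cards, triage cross-card note) and a GKS sandwich onto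
RECTILINEAR crosscuts (one local lattice geometry at the tip).

FILE LAYOUT
* Part A — OBJECTS (sorry-free definitions; to be landed verbatim by the lead as
  `Theorems/IsingBoundaryRatio/PfaffianSlitPeelingDefs.lean`, same namespace, so that stub files
  share the vocabulary): `xc`, `TG` (free critical two-point function on ANY subgraph of `ℤ²`),
  `RectCut` (axis-parallel polygonal crosscut presentation of `∂D' ∩ D`), `pbHull`, `rd` (the
  number `Φ'_A(0)` as a function of the hull), `cutSet`, `ballEdges`, `Peeling` (arc-ordered
  enumeration of the cut edges at mesh `δ`; its slit graphs `G k`, tips `c k`, partial slits, pulled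
  back partial hulls and their `rd`), `IsGBK` (the exact GBK increment identity + `W ≥ 0`),
  `Setting`, `BoundaryAnchors`, `Concl`.
* Part B — the seven STATEMENTS of the line as named `Prop`s.
* Part C — the seven REGISTERED STUBS `stub_*` (the only `sorry`s of the file).
* Part D — PROVED glue: `normalForm_of` (anchor transfer, kernel-checked) and the skeleton theorem
  `IsingBoundaryRatio_of : IsingBoundaryRatio` (closed modulo the stubs, through the landed
  `Negative.isingBoundaryRatio_iff_normalForm`).
* Part E — checks against the landed Negative lemmas (diagonal consistency).

DISPROOF USED (`Cruxes/IsingBoundaryRatio/Disproof.lean`, landed `Negative/IsingBoundaryRatio*.lean`):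
`isingBoundaryRatio_iff_normalForm` (the composition works on `NormalForm`);
`isingBoundaryRatio_false_without_IsRestrictionMap / _HasRestrictionDeriv` — honoured: every
statement keeps both clauses in the conclusion shell `Concl`, and `stub_slitDerivLimits` is the stub
that USES them (its end-foot limit identifies the peeled total with the crux's own `d`);
`eventually_ratio_mem_Ioc` (positivity of the reference ratio in the anchor transfer, Part D);
`crux_diag` (Part E: the restricted cases are true on the diagonal); `T_mono`,
`eventually_meshDomain_subset`, `T_pos_of_reachable` are the tools named for `stub_integration` /
`stub_sandwich`; the load-bearing INNER endpoint approximation `IsEndpointApprox D' a b` is a field of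
`Setting` and is what `BoundaryAnchors` + `stub_gbkPeeling`'s factorisation consume.
-/

noncomputable section

open scoped Topology
open MeasureTheory Filter Set Function Metric
open Literature.Probability.LatticeModels Literature.Probability.RandomPlanarGeometry
open UpperHalfPlane (upperHalfPlaneSet)
open Summit.CriticalPhenomena.SAWScalingLimit.Theses.SAWLoopFugacityFlow (IsingBoundaryRatio)
open Summit.CriticalPhenomena.SAWScalingLimit.Theorems.IsingBoundaryRatio.Negative
  (T ratio NormalForm isingBoundaryRatio_iff_normalForm eventually_ratio_mem_Ioc crux_diag)

namespace Summit.CriticalPhenomena.SAWScalingLimit.Cruxes.IsingBoundaryRatio.PfaffianSlitPeeling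

/-! ## Part A — objects of the line (definitions only; no statement of the line is asserted here) -/

/-- `x_c = tanh β_c = √2 − 1`, the critical high-temperature weight of `ℤ²`. -/
def xc : ℝ := Real.tanh criticalBetaTwo

/-- Every subgraph of the nearest-neighbour graph `ℤ²` is locally finite (noncomputable instance
term; all such terms are equal, `Fintype` being a subsingleton). -/
@[reducible] def lf {H : SimpleGraph (Site 2)} (h : H ≤ zdGraph 2) : H.LocallyFinite := fun x =>
  (((zdGraph 2).neighborSet x).toFinite.subset (SimpleGraph.neighborSet_mono h x)).fintype

/-- The free-boundary critical Ising two-point function `⟨σ_x σ_y⟩^free_{H; β_c, 0}` with finite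
volume `Λ` on an ARBITRARY graph `H` on the sites of `ℤ²` (intersected with `ℤ²`, which changes
nothing for the subgraphs of `Ω_δ ≤ ℤ²` used below, and makes the definition total). For
`H = discreteDomainGraph Ω δ` and `Λ = meshDomainFinset Ω δ` this is the landed `Negative.T Ω δ x y`
(same value; the `LocallyFinite` structures are propositionally equal). -/
def TG (H : SimpleGraph (Site 2)) (Λ : Finset (Site 2)) (x y : Site 2) : ℝ :=
  @isingTwoPoint (Site 2) (H ⊓ zdGraph 2) _ (lf inf_le_right) Λ criticalBetaTwo 0
    BoundaryCondition.free x y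

/-- Changing the graph along an equality and the (subsingleton) `LocallyFinite` structure does not
change the two-point function. -/
theorem isingTwoPoint_congr_graph {G₁ G₂ : SimpleGraph (Site 2)} (h : G₁ = G₂)
    (i₁ : G₁.LocallyFinite) (i₂ : G₂.LocallyFinite) (Λ : Finset (Site 2)) (β hh : ℝ)
    (bc : BoundaryCondition (Site 2)) (x y : Site 2) :
    @isingTwoPoint _ G₁ _ i₁ Λ β hh bc x y = @isingTwoPoint _ G₂ _ i₂ Λ β hh bc x y := by
  subst h
  have hi : i₁ = i₂ := Subsingleton.elim _ _
  subst hi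
  rfl

/-- On a subgraph `H ≤ ℤ²` with any `LocallyFinite` structure, `TG H` is the library two-point
function of `H` itself. -/
theorem TG_eq_of_le {H : SimpleGraph (Site 2)} (hH : H ≤ zdGraph 2) (inst : H.LocallyFinite)
    (Λ : Finset (Site 2)) (x y : Site 2) :
    TG H Λ x y = @isingTwoPoint _ H _ inst Λ criticalBetaTwo 0 BoundaryCondition.free x y :=
  isingTwoPoint_congr_graph (inf_eq_left.2 hH) _ _ Λ _ _ _ x y

/-- In particular `TG Ω_δ (meshDomainFinset Ω δ) = Negative.T Ω δ` (the landed normal-form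
two-point function). -/
theorem TG_discreteDomainGraph (Ω : Set ℂ) (δ : ℝ) (x y : Site 2) :
    TG (discreteDomainGraph Ω δ) (meshDomainFinset Ω δ) x y = T Ω δ x y :=
  TG_eq_of_le ((discreteDomainGraph_le_meshGraph Ω δ).trans (meshGraph_le_zdGraph Ω δ)) _ _ x y

/-- The closed mesh segment `[δx, δy]` of a lattice edge. -/
def meshSeg (δ : ℝ) (x y : Site 2) : Set ℂ := segment ℝ (meshPoint δ x) (meshPoint δ y)

/-- **Rectilinear crosscut presentation** of the hull subdomain `D' ⊆ D`: an axis-parallel simple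
polygonal arc `p 0 → p 1 → ⋯ → p (n+1)` (`n + 1 ≥ 1` legs) with its two feet `p 0`, `p (n+1)` on
`∂D`, its other points in `D`, whose trace inside `D` is exactly the crosscut `∂D' ∩ D`. (The
sandwich stub reduces the crux to subdomains admitting such a presentation; the peeling runs along
the legs from the START foot `p 0`.) -/
structure RectCut (D D' : DobrushinDomain) where
  /-- number of corners (`n + 1` legs) -/
  n : ℕ
  /-- the corner points, feet included -/
  p : Fin (n + 2) → ℂ
  /-- legs are axis-parallel -/
  axis : ∀ i : Fin (n + 1), (p i.castSucc).re = (p i.succ).re ∨ (p i.castSucc).im = (p i.succ).im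
  /-- legs are non-degenerate -/
  ne : ∀ i : Fin (n + 1), p i.castSucc ≠ p i.succ
  /-- the polygonal path is a simple arc: consecutive legs meet only at the common corner,
  non-consecutive legs are disjoint -/
  simple : ∀ i j : Fin (n + 1), i < j →
    segment ℝ (p i.castSucc) (p i.succ) ∩ segment ℝ (p j.castSucc) (p j.succ) ⊆
      (if i.val + 1 = j.val then ({p i.succ} : Set ℂ) else ∅)
  /-- the start foot lies on `∂D` -/
  start_mem : p 0 ∈ frontier D.carrier
  /-- the end foot lies on `∂D` -/
  end_mem : p (Fin.last (n + 1)) ∈ frontier D.carrier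
  /-- apart from its two feet the arc runs inside `D` -/
  inner_subset : ∀ i : Fin (n + 1),
    segment ℝ (p i.castSucc) (p i.succ) \ {p 0, p (Fin.last (n + 1))} ⊆ D.carrier
  /-- the trace of the arc in `D` is exactly the crosscut `∂D' ∩ D` -/
  frontier_eq : frontier D'.carrier ∩ D.carrier =
    (⋃ i : Fin (n + 1), segment ℝ (p i.castSucc) (p i.succ)) ∩ D.carrier

namespace RectCut

variable {D D' : DobrushinDomain} (C : RectCut D D')

/-- The `i`-th leg `[p i, p (i+1)]`. -/
def leg (i : Fin (C.n + 1)) : Set ℂ := segment ℝ (C.p i.castSucc) (C.p i.succ)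

/-- The whole polygonal arc (feet included). -/
def arc : Set ℂ := ⋃ i : Fin (C.n + 1), C.leg i

/-- The start foot (the slit is grown from here). -/
def pStart : ℂ := C.p 0

/-- The end foot (where the bite detaches). -/
def pEnd : ℂ := C.p (Fin.last (C.n + 1))

/-- The partial arc from the start foot through the legs `< i` and then along leg `i` up to the
point `q` (meaningful for `q ∈ leg i`): the continuum slit grown so far. -/
def upto (i : Fin (C.n + 1)) (q : ℂ) : Set ℂ :=
  (⋃ j : Fin (C.n + 1), ⋃ (_ : j < i), C.leg j) ∪ segment ℝ (C.p i.castSucc) q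

end RectCut

/-- The pulled-back hull `closure (ℍ ∖ φ⁻¹ U)` of a subset `U ⊆ D` under a chart `φ : ℍ → D`
(for `U = D'.carrier` this is LITERALLY the crux's `A`; for `U = D ∖ (partial slit)` it is the
partial slit hull `A_t`). -/
def pbHull {D : DobrushinDomain} (φ : ConformalEquiv upperHalfPlaneSet D.carrier) (U : Set ℂ) :
    Set ℂ :=
  closure (upperHalfPlaneSet \ {z | z ∈ upperHalfPlaneSet ∧ φ z ∈ U})

/-- The number `Φ'_A(0) ∈ (0, 1]` of a `*`-hull `A` as a FUNCTION of `A` (the derivative at `0` of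
the restriction map chosen by the tree's theorems `IsStarHull.existsUnique_isRestrictionMap_holds`,
`IsStarHull.exists_hasRestrictionDeriv_holds`; by uniqueness of `Φ_A` on `ℍ ∖ A` it is the `d` of
ANY restriction data of `A`); junk value `1` off `𝒬*`. -/
def rd (A : Set ℂ) : ℝ :=
  open scoped Classical in
  if h : IsStarHull A then
    Classical.choose (IsStarHull.exists_hasRestrictionDeriv_holds h
      (Classical.choose_spec (IsStarHull.existsUnique_isRestrictionMap_holds h)).1)
  else 1

/-- **The cut set at mesh `δ`**: the edges of `Ω_δ` that are NOT edges of `Ω'_δ` and whose closed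
mesh segment meets the (closed) arc. Deleting them from `Ω_δ` leaves a graph whose `a_δ`-component is
`Ω'_δ` (factorisation clause of `GBKPeeling`); no edge of `Ω'_δ` is ever cut. -/
def cutSet {D D' : DobrushinDomain} (C : RectCut D D') (δ : ℝ) : Set (Sym2 (Site 2)) :=
  {e | e ∈ (discreteDomainGraph D.carrier δ).edgeSet ∧ e ∉ (discreteDomainGraph D'.carrier δ).edgeSet ∧
    ∃ x y : Site 2, e = s(x, y) ∧ (meshSeg δ x y ∩ C.arc).Nonempty}

/-- The lattice edges having an endpoint whose mesh point lies in the closed ball `B̄(q, r)`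
(deleting them "closes the ball"). -/
def ballEdges (δ : ℝ) (q : ℂ) (r : ℝ) : Set (Sym2 (Site 2)) :=
  {e | ∃ x y : Site 2, e = s(x, y) ∧ (meshPoint δ x ∈ closedBall q r ∨ meshPoint δ y ∈ closedBall q r)}

/-- **A peeling of the crosscut at mesh `δ`**: an injective enumeration `k ↦ e_k = {u k, v k}` of the
cut set by edges of `Ω_δ`, each with a marked point `c k` of its mesh segment on the arc (its "crossing
point", on leg `leg k`), in ARC ORDER from the start foot: legs non-decreasing, and along a common leg
the crossing points move away from the leg's first corner. (No planarity/outer-face condition is a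
field: that the enumeration can be chosen so that the GBK identity `IsGBK` holds at every step is the
content of `stub_gbkPeeling`.) -/
structure Peeling (D D' : DobrushinDomain) (C : RectCut D D') (δ : ℝ) where
  /-- number of cut edges -/
  K : ℕ
  /-- first endpoint of the `k`-th cut edge (orientation chosen by the peeling) -/
  u : Fin K → Site 2
  /-- second endpoint of the `k`-th cut edge -/
  v : Fin K → Site 2
  /-- the leg carrying the `k`-th crossing point -/
  leg : Fin K → Fin (C.n + 1)
  /-- the `k`-th crossing point -/
  c : Fin K → ℂ
  adj : ∀ k, (discreteDomainGraph D.carrier δ).Adj (u k) (v k)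
  inj : Function.Injective fun k => s(u k, v k)
  range_eq : Set.range (fun k => s(u k, v k)) = cutSet C δ
  c_mem_seg : ∀ k, c k ∈ meshSeg δ (u k) (v k)
  c_mem_leg : ∀ k, c k ∈ C.leg (leg k)
  leg_mono : Monotone leg
  c_mono : ∀ k k', k ≤ k' → leg k = leg k' →
    dist (C.p (leg k).castSucc) (c k) ≤ dist (C.p (leg k').castSucc) (c k')

namespace Peeling

variable {D D' : DobrushinDomain} {C : RectCut D D'} {δ : ℝ} (P : Peeling D D' C δ)

/-- The `k`-th slit graph `G_k = Ω_δ − {e_j : j < k}` (`G 0 = Ω_δ`, `G K = Ω_δ − cutSet`). -/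
def G (k : ℕ) : SimpleGraph (Site 2) :=
  (discreteDomainGraph D.carrier δ).deleteEdges {e | ∃ j : Fin P.K, j.val < k ∧ e = s(P.u j, P.v j)}

/-- `G_0 = Ω_δ` (nothing deleted yet). -/
theorem G_zero : P.G 0 = discreteDomainGraph D.carrier δ := by
  have h : {e : Sym2 (Site 2) | ∃ j : Fin P.K, j.val < 0 ∧ e = s(P.u j, P.v j)} = ∅ := by
    ext e
    simp
  rw [Peeling.G, h, SimpleGraph.deleteEdges_empty]

/-- Every slit graph is a subgraph of `Ω_δ` (hence of `ℤ²`). -/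
theorem G_le (k : ℕ) : P.G k ≤ discreteDomainGraph D.carrier δ :=
  SimpleGraph.deleteEdges_le _

/-- `⟨σ_x σ_y⟩` in the slit graph `G_k`, free b.c., volume the mesh domain of `D`, at `β_c`. -/
def T (k : ℕ) (x y : Site 2) : ℝ := TG (P.G k) (meshDomainFinset D.carrier δ) x y

/-- At step `0` this is the crux's denominator `⟨σ_xσ_y⟩^free_{Ω_δ}` (`Negative.T D δ`). -/
theorem T_zero (x y : Site 2) :
    P.T 0 x y = Summit.CriticalPhenomena.SAWScalingLimit.Theorems.IsingBoundaryRatio.Negative.T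
      D.carrier δ x y := by
  rw [Peeling.T, G_zero, TG_discreteDomainGraph]

/-- The GBK `2×2` boundary minor at step `k` (anchors `a, b`; tip edge `u k, v k`; evaluated in the
graph AFTER the deletion): `W_k = ⟨a v⟩⟨b u⟩ − ⟨a u⟩⟨b v⟩`. -/
def W (k : Fin P.K) (a b : Site 2) : ℝ :=
  P.T (k.val + 1) a (P.v k) * P.T (k.val + 1) b (P.u k) - P.T (k.val + 1) a (P.u k) * P.T (k.val + 1) b (P.v k)

/-- **The exact GBK increment identity along the peeling** (one-edge identity
`e^{βσσ'} = cosh β (1 + x_c σσ')` + Groeneveld–Boel–Kasteleyn boundary Pfaffian for the four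
outer-face spins `a, b, u_k, v_k` in cyclic order):
`⟨ab⟩_{G_k} (1 + x_c⟨u v⟩_{G_{k+1}}) = ⟨ab⟩_{G_{k+1}} (1 + x_c⟨u v⟩_{G_{k+1}}) + x_c W_k` with `W_k ≥ 0`
(total positivity), at EVERY step. -/
def IsGBK (a b : Site 2) : Prop :=
  ∀ k : Fin P.K,
    P.T k.val a b * (1 + xc * P.T (k.val + 1) (P.u k) (P.v k)) =
        P.T (k.val + 1) a b * (1 + xc * P.T (k.val + 1) (P.u k) (P.v k)) + xc * P.W k a b ∧
      0 ≤ P.W k a b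

/-- The continuum partial slit after the `k`-th crossing: the arc from the start foot to `c k`. -/
def slit (k : Fin P.K) : Set ℂ := C.upto (P.leg k) (P.c k)

/-- `Φ'_{A_k}(0)` of the pulled-back partial slit hull `A_k = closure (ℍ ∖ φ⁻¹(D ∖ slit_k))`. -/
def dd (φ : ConformalEquiv upperHalfPlaneSet D.carrier) (k : Fin P.K) : ℝ :=
  rd (pbHull φ (D.carrier \ P.slit k))

/-- `η`-interior steps: the crossing point is at distance `≥ η` from both feet of the crosscut. -/
def Interior (η : ℝ) (k : Fin P.K) : Prop :=
  η ≤ dist (P.c k) C.pStart ∧ η ≤ dist (P.c k) C.pEnd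

end Peeling

/-- The crux's hypotheses on `(D, D', a, b)`, bundled (verbatim the antecedents of
`Negative.NormalForm`: BOTH endpoint approximations — the inner one is load-bearing, Disproof §3 —,
nesting, equal marked points, agreement in balls around them). -/
structure Setting (D D' : DobrushinDomain) (a b : ℝ → Site 2) : Prop where
  approx : SAW.IsEndpointApprox D a b
  approx' : SAW.IsEndpointApprox D' a b
  subset : D'.carrier ⊆ D.carrier
  pt_zero : D'.pt 0 = D.pt 0
  pt_one : D'.pt 1 = D.pt 1
  balls : ∃ ε : ℝ, 0 < ε ∧ D'.carrier ∩ ball (D.pt 0) ε = D.carrier ∩ ball (D.pt 0) ε ∧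
    D'.carrier ∩ ball (D.pt 1) ε = D.carrier ∩ ball (D.pt 1) ε

/-- **Boundary-vertex anchors**: eventually both lattice endpoints are discrete-boundary vertices of
`Ω_δ` (`meshBoundary`: a `ℤ²`-neighbour is outside `Ω_δ` or the closed mesh edge to it leaves
`cl D`), hence — `D` being Jordan, so that every bounded face of `Ω_δ` is a plaquette — exposed on the
OUTER FACE of `Ω_δ` and of all its subgraphs: the Groeneveld–Boel–Kasteleyn setting. -/
def BoundaryAnchors (D : DobrushinDomain) (a b : ℝ → Site 2) : Prop :=
  ∀ᶠ δ in 𝓝[>] (0 : ℝ), a δ ∈ meshBoundary D.carrier δ ∧ b δ ∈ meshBoundary D.carrier δ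

/-- The crux's conclusion shell for `(D, D', a, b)`: for EVERY admissible conformal datum
`(φ, A, Φ, d)` (both normalisation clauses kept — they are load-bearing, Disproof §4), the ratio tends
to `d^{1/2}`. -/
def Concl (D D' : DobrushinDomain) (a b : ℝ → Site 2) : Prop :=
  ∀ (φ : ConformalEquiv upperHalfPlaneSet D.carrier), D.IsChordalUniformizing φ →
    ∀ (A : Set ℂ), A = closure (upperHalfPlaneSet \ {z | z ∈ upperHalfPlaneSet ∧ φ z ∈ D'.carrier}) →
    ∀ (Φ : ConformalEquiv (upperHalfPlaneSet \ A) upperHalfPlaneSet) (d : ℝ),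
      IsRestrictionMap A Φ → HasRestrictionDeriv A Φ d →
      Tendsto (ratio D D' a b) (𝓝[>] 0) (𝓝 (d ^ ((1 : ℝ) / 2)))

/-- The crux's normal form is `Setting → Concl` (pure currying). -/
theorem normalForm_iff : NormalForm ↔ ∀ (D D' : DobrushinDomain) (a b : ℝ → Site 2),
    Setting D D' a b → Concl D D' a b := by
  constructor
  · intro h D D' a b hs φ hφ A hA Φ d hΦ hd
    exact h D D' a b hs.approx hs.approx' hs.subset hs.pt_zero hs.pt_one hs.balls φ hφ A hA Φ d hΦ hd
  · intro h D D' a b hD hD' hsub h0 h1 hε φ hφ A hA Φ d hΦ hd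
    exact h D D' a b ⟨hD, hD', hsub, h0, h1, hε⟩ φ hφ A hA Φ d hΦ hd

/-! ## Part B — the statements of the line -/

/-- **(1) Anchor locality** (value-free; the lemma shared with the cards fk-anchor-transfer /
fk-anchor-renewal / dirichlet-spinor): under the crux hypotheses there are REFERENCE endpoint
approximations `(a', b')`, eventually discrete-boundary vertices of `Ω_δ`, with asymptotically the same
nested ratio: `ratio(a,b)/ratio(a',b') → 1` (the double ratio
`[⟨ab⟩_{Ω'}/⟨a'b'⟩_{Ω'}] / [⟨ab⟩_Ω/⟨a'b'⟩_Ω]` forgets the far geometry). Implied by the crux together with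
the existence of boundary-vertex approximations; intended proof: Edwards–Sokal + b.c.-uniform RSW
(CDH16) + FKG/domain-Markov arm-origin forgetting across conformal half-annuli at the rough free prime
ends `a`, `b`. -/
def AnchorLocality : Prop :=
  ∀ (D D' : DobrushinDomain) (a b : ℝ → Site 2), Setting D D' a b →
    ∃ a' b' : ℝ → Site 2, Setting D D' a' b' ∧ BoundaryAnchors D a' b' ∧
      Tendsto (fun δ => ratio D D' a b δ / ratio D D' a' b' δ) (𝓝[>] 0) (𝓝 1)

/-- **The crux for boundary-vertex anchors** (all hull subdomains). -/
def BoundaryAnchorCase : Prop :=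
  ∀ (D D' : DobrushinDomain) (a b : ℝ → Site 2), Setting D D' a b → BoundaryAnchors D a b →
    Concl D D' a b

/-- **The crux for boundary-vertex anchors and RECTILINEAR crosscuts** (`C⁺` of the card's Transfer,
first conjunct): the target of the peeling analysis. -/
def RectilinearCase : Prop :=
  ∀ (D D' : DobrushinDomain) (a b : ℝ → Site 2), Setting D D' a b → BoundaryAnchors D a b →
    Nonempty (RectCut D D') → Concl D D' a b

/-- **(2) Rectilinear sandwich**: the rectilinear case implies the boundary-anchor case. Intended
proof: every hull subdomain `D'` is squeezed `D'_- ⊆ D' ⊆ D'_+` between hull subdomains with a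
single rectilinear crosscut (finitely many bites merged along the boundary from inside; finitely many
from outside by multiplicativity `Φ'_{A·B}(0) = Φ'_A(0)Φ'_B(0)` / kernel exhaustion), still agreeing
with `D` near `a, b` and still carrying the endpoint approximation; GKS
(`Negative.T_mono`, eventual nesting) gives `ratio_- ≤ ratio ≤ ratio_+` eventually, and
`Φ'_{A_±}(0) → Φ'_A(0)` (`HasRestrictionDeriv.tendsto_of_kernel_holds`, the tree's arc-hull
approximation files) closes the squeeze. -/
def Sandwich : Prop := RectilinearCase → BoundaryAnchorCase

/-- **(3) GBK peeling** (exact, finite, for all small `δ`): in the rectilinear boundary-anchor setting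
there is, eventually in `δ`, an arc-ordered peeling of the cut set along which the exact
Groeneveld–Boel–Kasteleyn increment identity with NONNEGATIVE minors holds at every step
(`Peeling.IsGBK`), and whose final slit graph gives back the subdomain's two-point function
(free-b.c. factorisation over the `a_δ`-component `= Ω'_δ`; volumes `meshDomainFinset D ⊇ D'`).
Cite-level input: Groeneveld–Boel–Kasteleyn, Physica A 93 (1978) 138–154 (boundary spins of a planar
free-b.c. Ising graph in cyclic order: `⟨σ_aσ_bσ_uσ_v⟩ = ⟨ab⟩⟨uv⟩ − ⟨au⟩⟨bv⟩ + ⟨av⟩⟨bu⟩`);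
`W ≥ 0` = Lis 2017 (arXiv:1606.04738) total positivity; outer-face bookkeeping: the cut edges are
deleted in arc order from the foot, ties at a lattice point broken "transversal before along". -/
def GBKPeeling : Prop :=
  ∀ (D D' : DobrushinDomain) (C : RectCut D D') (a b : ℝ → Site 2), Setting D D' a b →
    BoundaryAnchors D a b →
    ∀ᶠ δ in 𝓝[>] (0 : ℝ), ∃ P : Peeling D D' C δ,
      P.IsGBK (a δ) (b δ) ∧ P.T P.K (a δ) (b δ) = T D'.carrier δ (a δ) (b δ)

/-- **(4) Foot mixing** (a-priori estimate, value-free): closing all edges within distance `r` of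
EITHER FOOT of the crosscut changes `log ⟨σ_aσ_b⟩` by at most `ε` in EVERY intermediate slit graph of
every GBK peeling — uniformly in the step `k` (for `k` near the end this closes the gate between the
almost-detached bite and `Ω'_δ`) — and leaves `a_δ, b_δ` connected (positivity). Intended proof:
FK–Edwards–Sokal, free ≤ actual ≤ wired on the small arc `∂B(foot, r) ∩ D`, b.c.-uniform RSW in rough
discrete domains (Chelkak–Duminil-Copin–Hongler 2016), separation/gluing of the arms near `a`, `b`:
the ratio influence of an `r`-local boundary perturbation at distance `≥ ε₀` from the anchors is
`O(r^α)`; discrete uniform local connectedness of Jordan domains for the positivity. -/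
def FootMixing : Prop :=
  ∀ (D D' : DobrushinDomain) (C : RectCut D D') (a b : ℝ → Site 2), Setting D D' a b →
    BoundaryAnchors D a b →
    ∀ ε > (0 : ℝ), ∃ r > (0 : ℝ), ∀ᶠ δ in 𝓝[>] (0 : ℝ), ∀ P : Peeling D D' C δ, P.IsGBK (a δ) (b δ) →
      ∀ k : ℕ, k ≤ P.K → ∀ q : ℂ, (q = C.pStart ∨ q = C.pEnd) →
        0 < TG ((P.G k).deleteEdges (ballEdges δ q r)) (meshDomainFinset D.carrier δ) (a δ) (b δ) ∧
        Real.log (P.T k (a δ) (b δ) /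
            TG ((P.G k).deleteEdges (ballEdges δ q r)) (meshDomainFinset D.carrier δ) (a δ) (b δ)) ≤ ε

/-- **(5) Slit derivative limits** (pure continuum): along the rectilinear crosscut of a hull
subdomain, the restriction derivative of the pulled-back PARTIAL slit `Φ'_{A_t}(0)` tends to `1` as
the slit shrinks to the start foot, and to the crux's own `d = Φ'_A(0)` as the slit tip approaches the
end foot (Carathéodory kernel convergence for slits growing from `∂ℍ`; at the end the kernel of
`ℍ ∖ A_t ↓` is the COMPONENT `ℍ ∖ A = φ⁻¹(D')` of the interior of the intersection — the component
version of `HasRestrictionDeriv.tendsto_of_kernel`, with Schwarz reflection at `0`). This is the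
stub that uses the load-bearing clauses `IsRestrictionMap` / `HasRestrictionDeriv` (Disproof §4). -/
def SlitDerivLimits : Prop :=
  ∀ (D D' : DobrushinDomain) (C : RectCut D D'), D'.carrier ⊆ D.carrier → D'.pt 0 = D.pt 0 →
    D'.pt 1 = D.pt 1 →
    (∃ ε : ℝ, 0 < ε ∧ D'.carrier ∩ ball (D.pt 0) ε = D.carrier ∩ ball (D.pt 0) ε ∧
      D'.carrier ∩ ball (D.pt 1) ε = D.carrier ∩ ball (D.pt 1) ε) →
    ∀ (φ : ConformalEquiv upperHalfPlaneSet D.carrier), D.IsChordalUniformizing φ →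
    ∀ (A : Set ℂ), A = closure (upperHalfPlaneSet \ {z | z ∈ upperHalfPlaneSet ∧ φ z ∈ D'.carrier}) →
    ∀ (Φ : ConformalEquiv (upperHalfPlaneSet \ A) upperHalfPlaneSet) (d : ℝ),
      IsRestrictionMap A Φ → HasRestrictionDeriv A Φ d →
      Tendsto (fun q => rd (pbHull φ (D.carrier \ C.upto 0 q))) (𝓝[C.leg 0] C.pStart) (𝓝 1) ∧
      Tendsto (fun q => rd (pbHull φ (D.carrier \ C.upto (Fin.last C.n) q)))
        (𝓝[C.leg (Fin.last C.n) \ {C.pEnd}] C.pEnd) (𝓝 d)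

/-- **(6) Local density — THE HEART** (claim (3) of the card): along every GBK peeling, uniformly
over pairs of `η`-interior steps `k₁ ≤ k₂`, the lattice log-ratio `log(⟨ab⟩_{G_{k₁}}/⟨ab⟩_{G_{k₂}})`
(= the sum of the exact GBK increments between them) equals `½ log(Φ'_{A_{k₁}}(0)/Φ'_{A_{k₂}}(0))` —
the integral of the weight-`½` Loewner covariance density `−½·dhcap·(A−B)²/((W−A)²(W−B)²)` over that
stretch of the slit — up to an ADDITIVE `ε` (robust to `O(δ)` reorderings / ties). Intended proof:
two-term expansion of `y ↦ ⟨σ_aσ_y⟩_{G_k}` at the straight lattice slit tip (`y ∈ {u_k, v_k}`) with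
pattern-only constants `(λ₀, λ₁)` (CHI15 Thm 1.5 / Hongler–Smirnov subleading-coefficient technology
at a `√`-singularity), the Wronskian cancellation of the `λ₀²` term (the rough anchors enter only
through ratios), and the calibration of the one surviving constant `Λ = ½ ×` (hcap per lattice step)
— first in the half-plane / flat-rectangle geometry (Toeplitz, McCoy–Wu VII; HK13 Thm 25), triage
r1-1. Exponent `½` is OUTPUT of `Λ`; a drifting `Λ` kills the line (card falsifier (b)). -/
def LocalDensity : Prop :=
  ∀ (D D' : DobrushinDomain) (C : RectCut D D') (a b : ℝ → Site 2), Setting D D' a b →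
    BoundaryAnchors D a b →
    ∀ (φ : ConformalEquiv upperHalfPlaneSet D.carrier), D.IsChordalUniformizing φ →
    ∀ ε > (0 : ℝ), ∀ η > (0 : ℝ), ∀ᶠ δ in 𝓝[>] (0 : ℝ), ∀ P : Peeling D D' C δ, P.IsGBK (a δ) (b δ) →
      ∀ k₁ k₂ : Fin P.K, k₁ ≤ k₂ → P.Interior η k₁ → P.Interior η k₂ →
        |Real.log (P.T k₁.val (a δ) (b δ) / P.T k₂.val (a δ) (b δ)) -
            (1 / 2) * Real.log (P.dd φ k₁ / P.dd φ k₂)| ≤ ε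

/-- **(7) Integration** (discrete-to-continuum bookkeeping of the peeling): GBK peeling, local
density, foot mixing and the slit derivative limits give the rectilinear case. Intended proof: for a
GBK peeling `log(⟨ab⟩_Ω/⟨ab⟩_{Ω'}) = log(T_0/T_{k₋}) + log(T_{k₋}/T_{k₊}) + log(T_{k₊}/T_K)` with
`k₋, k₊` the first/last `η`-interior steps; the crossing points are `δ`-dense on interior stretches and,
for `η < η₀(C)`, the non-interior steps form an initial and a final block, inside the `r`-balls at the
feet; GKS graph-monotonicity (`isingCorr_free_mono_graph`, fixed volume) bounds the two end blocks by
the foot-mixing costs (`≤ ε` each, `r = r(ε)`, `η ≤ r/3`), local density controls the middle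
(`≤ ε`), and the slit derivative limits turn `½ log(d_{k₋}/d_{k₊})` into `−½ log d ± ε`; positivity
from `Negative.T_pos_of_reachable`, nesting from `Negative.eventually_meshDomain_subset`. -/
def Integration : Prop :=
  GBKPeeling → LocalDensity → FootMixing → SlitDerivLimits → RectilinearCase

/-! ## Part C — the registered stubs (the only `sorry`s of this file) -/

/-- **STUB 1 · `stub_anchorLocality`** (= `AnchorLocality`; size L; shared lemma). -/
theorem stub_anchorLocality : AnchorLocality := by
  sorry

/-- **STUB 2 · `stub_sandwich`** (= `Sandwich : RectilinearCase → BoundaryAnchorCase`; size M–L;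
planar approximation + GKS + kernel continuity, no Ising analysis). -/
theorem stub_sandwich : Sandwich := by
  sorry

/-- **STUB 3 · `stub_gbkPeeling`** (= `GBKPeeling`; size L; finite combinatorics: GBK boundary
Pfaffian, outer-face order of the peeling, component factorisation). -/
theorem stub_gbkPeeling : GBKPeeling := by
  sorry

/-- **STUB 4 · `stub_footMixing`** (= `FootMixing`; size L; FK ratio-influence of a local boundary
perturbation far from the anchors). -/
theorem stub_footMixing : FootMixing := by
  sorry

/-- **STUB 5 · `stub_slitDerivLimits`** (= `SlitDerivLimits`; size M; Carathéodory kernel theorem for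
boundary slits, component version at the closing end). -/
theorem stub_slitDerivLimits : SlitDerivLimits := by
  sorry

/-- **STUB 6 · `stub_localDensity`** (= `LocalDensity`; size XL; THE HARDEST STUB: two-term tip
expansion with universal lattice constants, Wronskian cancellation, calibration `Λ = ½`). -/
theorem stub_localDensity : LocalDensity := by
  sorry

/-- **STUB 7 · `stub_integration`** (= `Integration`; size M; GKS bracketing of the end blocks,
`δ`-density of crossings, `ε/4` bookkeeping along `𝓝[>] 0`). -/
theorem stub_integration : Integration := by
  sorry

/-! ## Part D — proved glue (no `sorry` below this line) -/

/-- **Anchor transfer (PROVED).** Anchor locality and the boundary-anchor case give the crux's normal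
form: for general endpoint approximations `(a, b)` pick the reference boundary anchors `(a', b')`;
`ratio(a', b') → d^{1/2}` by the boundary-anchor case (same `D, D'`, same conformal datum), the
reference ratio is eventually positive (`Negative.eventually_ratio_mem_Ioc`), and
`ratio(a,b) = [ratio(a,b)/ratio(a',b')] · ratio(a',b')` eventually, with the first factor `→ 1`. -/
theorem normalForm_of (hAL : AnchorLocality) (hBA : BoundaryAnchorCase) : NormalForm := by
  rw [normalForm_iff]
  intro D D' a b hs φ hφ A hA Φ d hΦ hd
  obtain ⟨a', b', hs', hbd, hlim⟩ := hAL D D' a b hs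
  have href : Tendsto (ratio D D' a' b') (𝓝[>] 0) (𝓝 (d ^ ((1 : ℝ) / 2))) :=
    hBA D D' a' b' hs' hbd φ hφ A hA Φ d hΦ hd
  have hpos : ∀ᶠ δ in 𝓝[>] (0 : ℝ), ratio D D' a' b' δ ≠ 0 :=
    (eventually_ratio_mem_Ioc hs'.approx hs'.approx' hs'.subset).mono fun δ h => h.1.ne'
  have hprod : Tendsto (fun δ => ratio D D' a b δ / ratio D D' a' b' δ * ratio D D' a' b' δ)
      (𝓝[>] 0) (𝓝 (1 * d ^ ((1 : ℝ) / 2))) :=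
    hlim.mul href
  rw [one_mul] at hprod
  refine hprod.congr' ?_
  filter_upwards [hpos] with δ hδ
  exact div_mul_cancel₀ _ hδ

/-- The rectilinear case from the four analytic/combinatorial statements (the integration step,
spelled out so that the dependency order of the line is visible in one term). -/
theorem rectilinearCase_of (hI : Integration) (hG : GBKPeeling) (hL : LocalDensity)
    (hF : FootMixing) (hS : SlitDerivLimits) : RectilinearCase :=
  hI hG hL hF hS

/-- **The composition with explicit hypotheses** (verbatim the statements of the seven stubs, in the
order anchorLocality, sandwich, gbkPeeling, footMixing, slitDerivLimits, localDensity, integration):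
they imply the crux's NORMAL FORM (`Negative.NormalForm`, landed equivalent of the crux). -/
theorem normalForm_of_stubs (h₁ : AnchorLocality) (h₂ : Sandwich) (h₃ : GBKPeeling) (h₄ : FootMixing)
    (h₅ : SlitDerivLimits) (h₆ : LocalDensity) (h₇ : Integration) : NormalForm :=
  normalForm_of h₁ (h₂ (rectilinearCase_of h₇ h₃ h₆ h₄ h₅))

/-- **The skeleton theorem: the crux `IsingBoundaryRatio` BY NAME from the seven registered stubs**,
through the landed `Negative.isingBoundaryRatio_iff_normalForm`. Its only `sorry`s are the stubs'. -/
theorem IsingBoundaryRatio_of :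
    Summit.CriticalPhenomena.SAWScalingLimit.Theses.SAWLoopFugacityFlow.IsingBoundaryRatio :=
  isingBoundaryRatio_iff_normalForm.2
    (normalForm_of_stubs stub_anchorLocality stub_sandwich stub_gbkPeeling stub_footMixing
      stub_slitDerivLimits stub_localDensity stub_integration)

/-! ## Part E — checks against the landed Negative lemmas (kernel-checked, no `sorry`) -/

/-- DIAGONAL CONSISTENCY (`Negative.crux_diag`): the conclusion shell holds outright for `D' = D`
(hull `A = ∅`, `d = 1`, ratio eventually `≡ 1`), so `RectilinearCase` / `BoundaryAnchorCase` restrict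
nothing that is false on the diagonal — no costume by an inconsistent special case. -/
example (D : DobrushinDomain) (a b : ℝ → Site 2) (hab : SAW.IsEndpointApprox D a b) : Concl D D a b :=
  fun φ _ A hA Φ d hΦ hd => crux_diag D a b hab φ A hA Φ d hΦ hd

/-- The crux's own hull is the pulled-back hull of `D'` in the sense of Part A (by `rfl`), so the
partial-slit hulls of `Peeling.dd` and the crux's `A` live in one family. -/
example {D : DobrushinDomain} (φ : ConformalEquiv upperHalfPlaneSet D.carrier) (D' : DobrushinDomain) :
    pbHull φ D'.carrier =
      closure (upperHalfPlaneSet \ {z | z ∈ upperHalfPlaneSet ∧ φ z ∈ D'.carrier}) := rfl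

end Summit.CriticalPhenomena.SAWScalingLimit.Cruxes.IsingBoundaryRatio.PfaffianSlitPeeling
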